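import Summits.CriticalPhenomena.CardyFormulaZ2.Theorems.CardySelfRefinementInterfaceToCardyBridge
import Summits.CriticalPhenomena.CardyFormulaZ2.Theorems.CardyComplexConeSLESixFamiliesGiveCardy
import Summits.CriticalPhenomena.CardyFormulaZ2.Theses.CardyRotToConf
import Summits.CriticalPhenomena.CardyFormulaZ2.Theses.CardyDualCurrent
import HarnessLib

/-!
# `InterfaceToCardy` (stmt-CriticalPhenomena-10278) — closed by composition of two LANDED theorems

Crux `Summit.CriticalPhenomena.CardyFormulaZ2.Theses.CardySelfRefinement.InterfaceToCardy`
(route `CardySelfRefinement`; shared with `CardyRotToConf.CardyRotToConfSLE6ToCardy` and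
`CardyDualCurrent.SLE6ToCardy`): "SLE₆ convergence of the bond-ℤ² exploration interface for every
Dobrushin domain and every admissible ℤ²-discretisation family ⇒ Cardy's formula for bond-ℤ²".

Both ingredients are already in the tree, sorry-free:

* `InterfaceToCardyBridge.interfaceToCardy_of_slesixFamiliesGiveCardy`
  (`Theorems/CardySelfRefinementInterfaceToCardyBridge.lean`, p80859):
  `CardyComplexCone.SLESixFamiliesGiveCardy → CardySelfRefinement.InterfaceToCardy`
  (the two items are the same proposition: bundle the six fields of `ZdDiscretisationFamily`);
* `Cruxes.SLESixFamiliesGiveCardy.CollarTouchSandwich.SLESixFamiliesGiveCardy_of`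
  (`Theorems/CardyComplexConeSLESixFamiliesGiveCardy.lean`, p95494, crux stmt-CriticalPhenomena-9654
  CLOSED 2026-08-16 by the collar-touch-sandwich line): `CardyComplexCone.SLESixFamiliesGiveCardy`.

Line `InterfaceToCardyProof` of the crux chain (ideator 1's candidate, identical in substance to line
`Sketch` / idea `compose-closed-sibling`), landed by the line lead.  The item is shared (same
normalised signature) with `CardyRotToConf.CardyRotToConfSLE6ToCardy` and
`CardyDualCurrent.SLE6ToCardy`; the conjecture-leaf form
`SLE6LimitZ2AllDiscretisations → CardyFormulaZ2` follows by
`InterfaceToCardyBridge.interfaceToCardy_iff_of_conjecture.1 interfaceToCardy_proof`.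
-/

namespace Summit.CriticalPhenomena.CardyFormulaZ2.Theorems

/-- **`InterfaceToCardy` holds**: composition of the landed bridge with the closed sibling crux
`SLESixFamiliesGiveCardy`. [folklore] -/
theorem interfaceToCardy_proof :
    Summit.CriticalPhenomena.CardyFormulaZ2.Theses.CardySelfRefinement.InterfaceToCardy :=
  InterfaceToCardyBridge.interfaceToCardy_of_slesixFamiliesGiveCardy
    Cruxes.SLESixFamiliesGiveCardy.CollarTouchSandwich.SLESixFamiliesGiveCardy_of

/-- The same item as wanted by route `CardyRotToConf` (decl `CardyRotToConfSLE6ToCardy`, literally the same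
body): closed by the same term. [folklore] -/
theorem cardyRotToConfSLE6ToCardy_proof :
    Summit.CriticalPhenomena.CardyFormulaZ2.Theses.CardyRotToConf.CardyRotToConfSLE6ToCardy :=
  interfaceToCardy_proof

/-- The same item as wanted by route `CardyDualCurrent` (support decl `SLE6ToCardy`, literally the same
body): closed by the same term. [folklore] -/
theorem cardyDualCurrentSLE6ToCardy_proof :
    Summit.CriticalPhenomena.CardyFormulaZ2.Theses.CardyDualCurrent.SLE6ToCardy :=
  interfaceToCardy_proof

end Summit.CriticalPhenomena.CardyFormulaZ2.Theorems
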